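/-
Copyright (c) 2026 the pub-hodgecm-mathlib formalisation cell (harness21).  Prover seat hodgecm-mathlib-F0P2-p11 (g2) (L1; LEAD F0P6-plan (g14) BATCH #56∕#59∕#61 «(iv)∕(o1)
`hRK₁` KIND-1 identification»), Track B «K2-LIT» ∕ hLiu418 #184♮, ROAD Φ, G5-b = Φ7-3: THE KIND-1 LETTERS OF RECORD — the cells cut ★ p861869 with the pole scalar
normalised away, pinned at ONE carrier and transported to every carrier; `hRK₁` of the TOP (★ ed. 9–15) PAID at these letters.  THEOREMS ONLY.
-/
import Summits.HodgeConjecture.HodgeConjecture.Theorems.K2LiuSiegelEisensteinRankOneCellsAssembly   -- ★ p861869 (cells cut) ⊇ ★ p861664, ★ p861715, ★ Φ1, ★ Φ2, ★ ed. 4a′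
import Summits.HodgeConjecture.HodgeConjecture.Theorems.K2LiuSiegelUnipotentHaarPinned             -- ★ Φ3b `locallyCompactSpace_unipDelta`, `secondCountableTopology_unipDelta`
import Mathlib.MeasureTheory.Measure.Haar.Unique                                                    -- `isMulLeftInvariant_eq_smul`, `haarScalarFactor_pos_of_isHaarMeasure`
import HarnessLib

/-!
# Crux `HLiu418`, socket #41, KIND 1 — THE KIND-1 LETTERS OF RECORD: the normalised cells are CARRIER-FREE, the pole scalar is `(s − ½)⁻¹`,
# and the TOP's identification letter `hRK₁` holds at every carrier once the two continued cell terms are pinned at ONE carrier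

Cell `hodgecm-mathlib`, crux item hLiu418 = `stmt-HodgeConjecture-24832` (helper lane, count-neutral); squad K2 ∕ K2Liu, LEAD F0P6-plan (g14) (BATCH #56 «F0P2-p11 (g2)
(h4)∕(o1) `hRK₁` KIND-1 organs», #61 (5) «(o1) = the deepest unowned dependency of the #42S tie»), desk = #41 TOP author K2E5-p17 (g8); prover F0P2-p11 (g2).
THEOREMS ONLY (no `def`, no `instance`, no notation, no named-fact hypothesis, no `sorry`).

THE LETTERS OF RECORD (pre-spec F0P2-p11 (g2) 2026-09-04T22:05Z).  In the TOP's KIND-1 binders (★ p861664 ∕ ★ ed. 9–15: term data `(ι, a, ρb, ρa, G, Eb, Ea)` with the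
identification `hRK₁ : E_S(h; f_s) = Σ_j a_j·(ρb·Eb_j + ρa·Ea_j)` on `n∕2 < re s` at EVERY carrier `(νN, β)`) take
  **`ι := fun _ => Unit`, `a := 1`, `ρb := 1`, `ρa S s := (s − ½)⁻¹`, `G := 1`, `Eb S _ := Ebc S`, `Ea S _ := Eac S`**,
where `Ebc, Eac : Skew → ℂ → H(𝔸) → ℂ` are the CONTINUED NORMALISED MIDDLE-CELL term and the CONTINUED `(s − ½)·`NORMALISED-WHITTAKER term: two functions,
holomorphic on `{0 < re s}` (their owners' content, K1-b♮ ∕ K1-a♮) and PINNED on `{n∕2 < re s}` at ONE compactly supported carrier `(νN₀, β₀ ≤ 𝟙_{K₀})` by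
  `Ebc S s h = (∫β₀ dνN₀)⁻¹ • MID_S(νN₀, β₀, f_s, h)`,   `Eac S s h = (s − ½) · ((∫β₀ dνN₀)⁻¹ • W_S(νN₀)(f_s)(h))`
(`MID_S` = ★ Φ2's middle-cell expression verbatim with O41.4's rational Weyl presentation `wq`, `W_S = whittakerDelta`).  Then `hG`, `hρb`, `had` are `differentiableOn_const`,
`hGρ` is `1 = (s − ½)(s − ½)⁻¹` off `½`, and (S5-d)'s `hdead` reads `1 * Eac X ½ h = 0` (the continued `(s − ½)·W_X(g_s)(h)∕∫β` vanishes at `½`).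
WHAT THIS FILE PROVES.
* §0 `exists_haar_eq_nnreal_smul` — two Haar measures on `N_Δ(𝔸)` differ by a positive scalar (Mathlib `isMulLeftInvariant_eq_smul`; ★ Φ3b: `N_Δ(𝔸)` locally compact,
  second countable); `fourierCoeffDelta_nnreal_smul_measure` — `fourierCoeffDelta (c • νN) β = fourierCoeffDelta νN β` (`c ≠ 0`): the normalisation `(∫β)⁻¹` absorbs the scalar.
* §1 **`smul_whittakerDelta_carrier_eq`** — `(∫β dνN)⁻¹ • W_S(νN)(f)(h)` is CARRIER-FREE: the same for any two Haar measures `νN, νN'` and any two `N_Δ(L⁺)`-covering weights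
  `β, β'` (Haar uniqueness + ★ Φ1 `lintegral_eq_of_isCoveringWeight`: all covering weights have the same mass); NO convergence or finiteness hypothesis (junk values match).
* §1′ **`fourierCoeffDelta_eisensteinSeriesDelta_carrier_eq`** — `E_S(h; f) = fourierCoeffDelta νN β S (E(·; f)) h` is carrier-free (`χ` unitary, `n∕2 < re s`, `f ∈ I(s, χ)`
  continuous; ★ Φ1 weight independence — `E` continuous ★ G8, left-`H(L⁺)`-invariant ★ #10b, bounded along `N_Δ(𝔸)`-orbits ★ p861715 — and §0).
* §2 **`smul_middle_carrier_eq`** — the normalised middle-cell term `(∫β dνN)⁻¹ • MID_S(νN, β, f, h)` is carrier-free among COMPACTLY SUPPORTED carriers for `ψ_S ≠ 1`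
  (`S ≠ 0` `T_L`-skew, ★ (T2′)) on `n∕2 < re s`: it equals `E_S − (∫β)⁻¹ • W_S` there (★ Φ2 cells with O41.4's `hH` ★ ed. 4a′), and both pieces are carrier-free (§1, §1′).
* §3 **`fourierCoeffDelta_rankOne_eq_of_record`** — for letters `Ebc, Eac` pinned at ONE compactly supported carrier on `{n∕2 < re s}` (rank-one `S`: `S ≠ 0`, `det S = 0`):
  `E_S(h; f_s) = Ebc S s h + (s − ½)⁻¹ · Eac S s h` at EVERY Haar `νN` and EVERY covering weight `β` (★ p861869 §1 `fourierCoeffDelta_rankOne_eq_of_cells` fed by §1–§2);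
  **`fourierCoeffDelta_rankOne_eq_of_record_sum`** — the same in the TOP's `hRK₁` BYTES at the letters of record (`∑ j : Unit, 1 * (1 * Ebc S s h + (s − ½)⁻¹ * Eac S s h)`),
  i.e. the `hRK₁` hole of ★ ed. 9∕14∕15 and of ★ EdTwo p862260 at `f := g_{S,G}`.
* §4 **`exists_kindOne_sixLetters_of_record`** — the SIX kind-1 letters of ★ ed. 3b (★ p861869 §2's conclusion verbatim) from the two ONE-CARRIER packages
  K1-b♮ (`Ebc`: holomorphy, weighted growth `ub`, pin) and K1-a♮ (`Eac`: holomorphy, weighted growth `uG`, pin), `Summable (ub + uG)`.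
WHAT REMAINS OF KIND 1 (honest): the two continuations-with-growth themselves — K1-b♮ (line term: ★ p861327 corner-line integral = carrier-«A» rank-one Whittaker function,
(T4)) and K1-a♮ (`(s − ½)·W_S`: ★ p861405 `N_χ(𝔸)`-period, ★ p861975∕p862048 coordinates + Fubini, GL₂ Gindikin–Karpelevich, carrier A).  They are NOT here.
References: [KudlaRallis1994] §2; [MoeglinWaldspurger1995] I.2.6, II.1.7, IV.1.8–IV.1.11; [Tan1999] §3, §4 Prop. 4.8; [Shimura1997] §18.3–18.5.
HONEST LABEL.  Count-neutral helper, hypothesis-first on K1-b♮∕K1-a♮; `HC_CM` is proved only modulo the 7 printed citations (2 remaining named inputs: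
hLiu418 = `stmt-HodgeConjecture-24832`, h413 = `stmt-HodgeConjecture-24833`) until rung 0 closes.
-/

set_option autoImplicit false
set_option linter.dupNamespace false -- the mandated namespace repeats `HodgeConjecture.HodgeConjecture`

noncomputable section

open scoped Matrix ENNReal NNReal Topology ComplexConjugate
open NumberField IsDedekindDomain MeasureTheory MeasureTheory.Measure Filter Set Function Metric
open Literature.NumberTheory.Automorphic Literature.NumberTheory.Automorphic.UnitaryGroup Literature.NumberTheory.GaloisRepresentations
open Literature.NumberTheory.GelbartRogawski1991 Literature.NumberTheory.GelbartRogawski1991.GRConstruction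
open Literature.NumberTheory.K2Lit.SiegelDoubled Literature.MeasureTheory.Group
open UnitaryDualPair

namespace Summit.HodgeConjecture.HodgeConjecture.Cruxes.HLiu418.K2LiuKindOneLettersOfRecord

open K2LiuSiegelUnipotentFourierDefs K2LiuSiegelUnipotentCharacters K2LiuUnipotentCoveringWeight K2LiuSiegelFourierCoeffDelta
open K2LiuSiegelEisensteinCoeffCells (fourierCoeffDelta_eisensteinSeriesDelta_of_ne_one exists_unipDeltaChar_ne_one_of_ne_zero)
open K2LiuSiegelEisensteinConstantTermFiniteness (lintegral_tsum_enorm_mul_weight_ne_top)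
open K2LiuSiegelEisensteinContinuous (continuous_eisensteinSeriesDelta)
open K2LiuSiegelEisensteinDoubledLeftInvariant (siegelEisensteinDoubledLeftInvariant)
open K2LiuFourierCoeffDeltaContinuous (exists_bound_mul_of_unipDeltaRat_invariant)
open K2LiuSiegelUnipotentHaarPinned (locallyCompactSpace_unipDelta secondCountableTopology_unipDelta)
open K2LiuSiegelEisensteinRankOneCellsAssembly (fourierCoeffDelta_rankOne_eq_of_cells exists_kindOne_sixLetters_of_cells)

variable (L : Type) [Field L] [NumberField L] [IsCMField L]
variable {N M n : ℕ} (e : Fin N × Fin M ≃ Fin n)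
  (dV : Fin N → L) (hdV : ∀ i, IsCMField.complexConj L (dV i) = dV i)
  (dW : Fin M → L) (hdW : ∀ i, IsCMField.complexConj L (dW i) = dW i)

/-! ## §0 Haar uniqueness on `N_Δ(𝔸)` and the scalar-invariance of the normalised coefficient -/

/-- **Two Haar measures on `N_Δ(𝔸)` differ by a positive scalar**: `νN' = c • νN`, `c ≠ 0` (Mathlib `isMulLeftInvariant_eq_smul`; `N_Δ(𝔸)` is locally compact and second
countable, ★ Φ3b). [cite: MoeglinWaldspurger1995, I.2.6] -/
theorem exists_haar_eq_nnreal_smul [MeasurableSpace (unipDelta L e dV hdV dW hdW)] [BorelSpace (unipDelta L e dV hdV dW hdW)]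
    (νN νN' : Measure (unipDelta L e dV hdV dW hdW)) [νN.IsHaarMeasure] [νN'.IsHaarMeasure] :
    ∃ c : ℝ≥0, c ≠ 0 ∧ νN' = c • νN := by
  haveI : LocallyCompactSpace (unipDelta L e dV hdV dW hdW) := locallyCompactSpace_unipDelta L e dV hdV dW hdW
  haveI : SecondCountableTopology (unipDelta L e dV hdV dW hdW) := secondCountableTopology_unipDelta L e dV hdV dW hdW
  exact ⟨haarScalarFactor νN' νN, (haarScalarFactor_pos_of_isHaarMeasure νN' νN).ne', isMulLeftInvariant_eq_smul νN' νN⟩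

omit [NumberField L] in
/-- the real bookkeeping behind every normalisation: `(c·t)⁻¹ · c = t⁻¹` for `c ≠ 0` (also at the junk value `t = 0`). [folklore] -/
theorem inv_mul_mul_cancel_left {c : ℝ} (hc : c ≠ 0) (t : ℝ) : (c * t)⁻¹ * c = t⁻¹ := by
  rw [mul_inv, mul_comm c⁻¹, mul_assoc, inv_mul_cancel₀ hc, mul_one]

/-- **`fourierCoeffDelta (c • νN) β = fourierCoeffDelta νN β`** for `c ≠ 0`: the normalisation `(∫β dνN)⁻¹` absorbs the Haar scalar (no hypothesis on `β`, `φ`; junk values match).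
[cite: MoeglinWaldspurger1995, I.2.6] -/
theorem fourierCoeffDelta_nnreal_smul_measure [MeasurableSpace (unipDelta L e dV hdV dW hdW)] (νN : Measure (unipDelta L e dV hdV dW hdW))
    {c : ℝ≥0} (hc : c ≠ 0) (β : unipDelta L e dV hdV dW hdW → ℝ≥0∞) (S : Matrix (Fin n) (Fin n) L) (φ : HA L e dV hdV dW hdW → ℂ) (h : HA L e dV hdV dW hdW) :
    fourierCoeffDelta L e dV hdV dW hdW (c • νN) β S φ h = fourierCoeffDelta L e dV hdV dW hdW νN β S φ h := by
  rw [fourierCoeffDelta_def, fourierCoeffDelta_def, lintegral_smul_measure, integral_smul_nnreal_measure, ENNReal.smul_def, smul_eq_mul,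
    ENNReal.toReal_mul, ENNReal.coe_toReal, NNReal.smul_def, smul_smul, inv_mul_mul_cancel_left (NNReal.coe_ne_zero.2 hc)]

/-! ## §1 The normalised singular/nonsingular big-cell (Whittaker) term is carrier-free -/

/-- **`(∫β dνN)⁻¹ • W_S(νN)(f)(h)` IS CARRIER-FREE**: for any two Haar measures `νN, νN'` on `N_Δ(𝔸)` and any two `N_Δ(L⁺)`-covering weights `β, β'`,
`(∫β dνN)⁻¹ • whittakerDelta νN S f h = (∫β' dνN')⁻¹ • whittakerDelta νN' S f h` (Haar uniqueness §0; all covering weights have the same mass ★ Φ1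
`lintegral_eq_of_isCoveringWeight`; no convergence or finiteness hypothesis — the junk values agree). [cite: KudlaRallis1994, §2] [cite: MoeglinWaldspurger1995, I.2.6, II.1.7] -/
theorem smul_whittakerDelta_carrier_eq [MeasurableSpace (unipDelta L e dV hdV dW hdW)] [BorelSpace (unipDelta L e dV hdV dW hdW)]
    (νN νN' : Measure (unipDelta L e dV hdV dW hdW)) [νN.IsHaarMeasure] [νN'.IsHaarMeasure]
    {β β' : unipDelta L e dV hdV dW hdW → ℝ≥0∞} (hβ : IsCoveringWeight (unipDeltaRat L e dV hdV dW hdW) β)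
    (hβ' : IsCoveringWeight (unipDeltaRat L e dV hdV dW hdW) β') (S : Matrix (Fin n) (Fin n) L) (f : HA L e dV hdV dW hdW → ℂ) (h : HA L e dV hdV dW hdW) :
    ((∫⁻ u, β u ∂νN).toReal⁻¹ : ℝ) • whittakerDelta L e dV hdV dW hdW νN S f h =
      ((∫⁻ u, β' u ∂νN').toReal⁻¹ : ℝ) • whittakerDelta L e dV hdV dW hdW νN' S f h := by
  obtain ⟨c, hc, rfl⟩ := exists_haar_eq_nnreal_smul L e dV hdV dW hdW νN νN'
  rw [whittakerDelta_def, whittakerDelta_def, integral_smul_nnreal_measure, lintegral_smul_measure,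
    ← lintegral_eq_of_isCoveringWeight L e dV hdV dW hdW νN hβ hβ', ENNReal.smul_def, smul_eq_mul, ENNReal.toReal_mul, ENNReal.coe_toReal,
    NNReal.smul_def, smul_smul, inv_mul_mul_cancel_left (NNReal.coe_ne_zero.2 hc)]

/-! ## §1′ The Fourier coefficient of the Eisenstein series is carrier-free -/

/-- **`E_S(h; f)` IS CARRIER-FREE**: `χ` unitary, `n∕2 < re s`, `f ∈ I(s, χ)` continuous (`dV i, dW j ≠ 0`); for Haar measures `νN, νN'` and covering weights `β, β'`
with `∫β dνN < ∞`: `fourierCoeffDelta νN β S (E(·; f)) h = fourierCoeffDelta νN' β' S (E(·; f)) h` (§0 for the measure; ★ Φ1 `fourierCoeffDelta_eq_of_isCoveringWeight` for the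
weight: `E(·; f)` is continuous ★ G8, left-`H(L⁺)`-invariant ★ #10b and bounded along `N_Δ(𝔸)`-orbits ★ p861715). [cite: MoeglinWaldspurger1995, I.2.6, II.1.7] [cite: Tan1999, §3] -/
theorem fourierCoeffDelta_eisensteinSeriesDelta_carrier_eq (hdV0 : ∀ i, dV i ≠ 0) (hdW0 : ∀ i, dW i ≠ 0)
    [MeasurableSpace (unipDelta L e dV hdV dW hdW)] [BorelSpace (unipDelta L e dV hdV dW hdW)]
    {χ : HeckeCharacter L} (hχ : χ.IsUnitary) {s : ℂ} (hs : (n : ℝ) / 2 < s.re)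
    {f : HA L e dV hdV dW hdW → ℂ} (hf : IsSiegelDeltaSection L e dV hdV dW hdW χ s f) (hfc : Continuous f)
    (νN νN' : Measure (unipDelta L e dV hdV dW hdW)) [νN.IsHaarMeasure] [νN'.IsHaarMeasure]
    {β β' : unipDelta L e dV hdV dW hdW → ℝ≥0∞} (hβ : IsCoveringWeight (unipDeltaRat L e dV hdV dW hdW) β)
    (hβ' : IsCoveringWeight (unipDeltaRat L e dV hdV dW hdW) β') (hβtop : ∫⁻ u, β u ∂νN ≠ ∞) (S : Matrix (Fin n) (Fin n) L) (h : HA L e dV hdV dW hdW) :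
    fourierCoeffDelta L e dV hdV dW hdW νN β S (eisensteinSeriesDelta L e dV hdV dW hdW f) h =
      fourierCoeffDelta L e dV hdV dW hdW νN' β' S (eisensteinSeriesDelta L e dV hdV dW hdW f) h := by
  obtain ⟨c, hc, rfl⟩ := exists_haar_eq_nnreal_smul L e dV hdV dW hdW νN νN'
  rw [fourierCoeffDelta_nnreal_smul_measure L e dV hdV dW hdW νN hc]
  -- `E(·; f)`: continuous, left-`H(L⁺)`-invariant, bounded along `N_Δ(𝔸)`-orbits
  have hEc : Continuous (eisensteinSeriesDelta L e dV hdV dW hdW f) := continuous_eisensteinSeriesDelta L e dV hdV hdV0 dW hdW hdW0 hχ hs hf hfc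
  have hEinv : ∀ (γ : unipDeltaRat L e dV hdV dW hdW) (x : HA L e dV hdV dW hdW),
      eisensteinSeriesDelta L e dV hdV dW hdW f (((γ : unipDelta L e dV hdV dW hdW) : HA L e dV hdV dW hdW) * x) = eisensteinSeriesDelta L e dV hdV dW hdW f x :=
    fun γ x => siegelEisensteinDoubledLeftInvariant L e dV hdV dW hdW χ s f hf
      ⟨((γ : unipDelta L e dV hdV dW hdW) : HA L e dV hdV dW hdW), (mem_unipDeltaRat_iff L e dV hdV dW hdW _).1 γ.2⟩ x
  exact fourierCoeffDelta_eq_of_isCoveringWeight L e dV hdV dW hdW νN hβ hβ' hβtop S (hEc.comp (continuous_subtype_val.mul continuous_const))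
    (exists_bound_mul_of_unipDeltaRat_invariant L e dV hdV dW hdW hdV0 hdW0 hEc hEinv h) fun γ u => by
      rw [Subgroup.coe_mul, mul_assoc, hEinv]

/-! ## §2 The normalised middle-cell term is carrier-free (compactly supported carriers, `ψ_S ≠ 1`, `n∕2 < re s`) -/

/-- **THE NORMALISED MIDDLE-CELL TERM IS CARRIER-FREE.**  `χ` unitary, `n∕2 < re s`, `f ∈ I(s, χ)` continuous, `S ≠ 0` a `T_L`-skew index (so `ψ_S ≠ 1`, ★ (T2′)); for any two
Haar measures `νN, νN'` and any two COMPACTLY SUPPORTED covering weights `β ≤ 𝟙_K`, `β' ≤ 𝟙_{K'}` of finite mass: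
`(∫β dνN)⁻¹ • MID_S(νN, β, f, h) = (∫β' dνN')⁻¹ • MID_S(νN', β', f, h)` — both equal `E_S(h; f) − (∫β)⁻¹ • W_S(f)(h)` by ★ Φ2
`fourierCoeffDelta_eisensteinSeriesDelta_of_ne_one` (O41.4's `hH` ★ ed. 4a′ `lintegral_tsum_enorm_mul_weight_ne_top`), and the two pieces are carrier-free (§1′, §1).
[cite: KudlaRallis1994, §2] [cite: MoeglinWaldspurger1995, II.1.7] [cite: Tan1999, §3] -/
theorem smul_middle_carrier_eq (hdV0 : ∀ i, dV i ≠ 0) (hdW0 : ∀ i, dW i ≠ 0) (hn : 0 < n)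
    [MeasurableSpace (unipDelta L e dV hdV dW hdW)] [BorelSpace (unipDelta L e dV hdV dW hdW)]
    (wq : unipDeltaRat L e dV hdV dW hdW → ratH L e dV hdV dW hdW)
    (hwq : ∀ ν, ((wq ν : ratH L e dV hdV dW hdW) : HA L e dV hdV dW hdW) = weylDelta L e dV hdV dW hdW * ((ν : unipDelta L e dV hdV dW hdW) : HA L e dV hdV dW hdW))
    {χ : HeckeCharacter L} (hχ : χ.IsUnitary) {s : ℂ} (hs : (n : ℝ) / 2 < s.re)
    {f : HA L e dV hdV dW hdW → ℂ} (hf : IsSiegelDeltaSection L e dV hdV dW hdW χ s f) (hfc : Continuous f)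
    {S : Matrix (Fin n) (Fin n) L}
    (hS : S ∈ skewMatrices ((IsCMField.complexConj L : L ≃ₐ[Fp L] L) : L →+* L) ((gramR L e dV hdV dW hdW).map (algebraMap (Fp L) L))) (hS0 : S ≠ 0)
    (νN νN' : Measure (unipDelta L e dV hdV dW hdW)) [νN.IsHaarMeasure] [νN'.IsHaarMeasure]
    {β β' : unipDelta L e dV hdV dW hdW → ℝ≥0∞} (hβ : IsCoveringWeight (unipDeltaRat L e dV hdV dW hdW) β)
    (hβ' : IsCoveringWeight (unipDeltaRat L e dV hdV dW hdW) β') (hβtop : ∫⁻ u, β u ∂νN ≠ ∞) (hβ'top : ∫⁻ u, β' u ∂νN' ≠ ∞)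
    {K K' : Set (unipDelta L e dV hdV dW hdW)} (hK : IsCompact K) (hβK : ∀ u, β u ≤ K.indicator 1 u) (hK' : IsCompact K') (hβK' : ∀ u, β' u ≤ K'.indicator 1 u)
    (h : HA L e dV hdV dW hdW) :
    ((∫⁻ u, β u ∂νN).toReal⁻¹ : ℝ) •
        (∫ u, (β u).toReal • (conj (unipDeltaChar L e dV hdV dW hdW S (u : HA L e dV hdV dW hdW) : ℂ) *
          (∑' q : ↥(({Quotient.mk (MulAction.orbitRel (siegelDeltaRat L e dV hdV dW hdW) (ratH L e dV hdV dW hdW)) 1} ∪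
            Set.range (fun ν : unipDeltaRat L e dV hdV dW hdW =>
              (Quotient.mk (MulAction.orbitRel (siegelDeltaRat L e dV hdV dW hdW) (ratH L e dV hdV dW hdW)) (wq ν) :
                SiegelDeltaQuot L e dV hdV dW hdW)))ᶜ : Set (SiegelDeltaQuot L e dV hdV dW hdW)),
          f ((((Quotient.out (q : SiegelDeltaQuot L e dV hdV dW hdW) : ratH L e dV hdV dW hdW) : HA L e dV hdV dW hdW)) *
            ((u : HA L e dV hdV dW hdW) * h)))) ∂νN) =
      ((∫⁻ u, β' u ∂νN').toReal⁻¹ : ℝ) •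
        (∫ u, (β' u).toReal • (conj (unipDeltaChar L e dV hdV dW hdW S (u : HA L e dV hdV dW hdW) : ℂ) *
          (∑' q : ↥(({Quotient.mk (MulAction.orbitRel (siegelDeltaRat L e dV hdV dW hdW) (ratH L e dV hdV dW hdW)) 1} ∪
            Set.range (fun ν : unipDeltaRat L e dV hdV dW hdW =>
              (Quotient.mk (MulAction.orbitRel (siegelDeltaRat L e dV hdV dW hdW) (ratH L e dV hdV dW hdW)) (wq ν) :
                SiegelDeltaQuot L e dV hdV dW hdW)))ᶜ : Set (SiegelDeltaQuot L e dV hdV dW hdW)),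
          f ((((Quotient.out (q : SiegelDeltaQuot L e dV hdV dW hdW) : ratH L e dV hdV dW hdW) : HA L e dV hdV dW hdW)) *
            ((u : HA L e dV hdV dW hdW) * h)))) ∂νN') := by
  obtain ⟨u₀, hu₀⟩ := exists_unipDeltaChar_ne_one_of_ne_zero (e := e) (dV := dV) (hdV := hdV) (dW := dW) (hdW := hdW) hdV0 hdW0 hS hS0
  -- at any compactly supported carrier the normalised middle term is `E_S − (∫β)⁻¹ • W_S` (★ Φ2 with ★ ed. 4a′'s `hH`)
  have key : ∀ (μ : Measure (unipDelta L e dV hdV dW hdW)) [μ.IsHaarMeasure] {γ : unipDelta L e dV hdV dW hdW → ℝ≥0∞},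
      IsCoveringWeight (unipDeltaRat L e dV hdV dW hdW) γ → ∫⁻ u, γ u ∂μ ≠ ∞ →
      ∀ {K₁ : Set (unipDelta L e dV hdV dW hdW)}, IsCompact K₁ → (∀ u, γ u ≤ K₁.indicator 1 u) →
      ((∫⁻ u, γ u ∂μ).toReal⁻¹ : ℝ) •
          (∫ u, (γ u).toReal • (conj (unipDeltaChar L e dV hdV dW hdW S (u : HA L e dV hdV dW hdW) : ℂ) *
            (∑' q : ↥(({Quotient.mk (MulAction.orbitRel (siegelDeltaRat L e dV hdV dW hdW) (ratH L e dV hdV dW hdW)) 1} ∪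
              Set.range (fun ν : unipDeltaRat L e dV hdV dW hdW =>
                (Quotient.mk (MulAction.orbitRel (siegelDeltaRat L e dV hdV dW hdW) (ratH L e dV hdV dW hdW)) (wq ν) :
                  SiegelDeltaQuot L e dV hdV dW hdW)))ᶜ : Set (SiegelDeltaQuot L e dV hdV dW hdW)),
            f ((((Quotient.out (q : SiegelDeltaQuot L e dV hdV dW hdW) : ratH L e dV hdV dW hdW) : HA L e dV hdV dW hdW)) *
              ((u : HA L e dV hdV dW hdW) * h)))) ∂μ) =
        fourierCoeffDelta L e dV hdV dW hdW μ γ S (eisensteinSeriesDelta L e dV hdV dW hdW f) h -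
          ((∫⁻ u, γ u ∂μ).toReal⁻¹ : ℝ) • whittakerDelta L e dV hdV dW hdW μ S f h := by
    intro μ _ γ hγ hγtop K₁ hK₁ hγK₁
    have hH := lintegral_tsum_enorm_mul_weight_ne_top L e dV hdV dW hdW hdV0 hdW0 hχ hs hf hfc μ hγtop hK₁ hγK₁ h
    rw [fourierCoeffDelta_eisensteinSeriesDelta_of_ne_one wq hwq hn μ hγ hf hfc h hH S hu₀, smul_add, add_sub_cancel_left]
  rw [key νN hβ hβtop hK hβK, key νN' hβ' hβ'top hK' hβK',
    fourierCoeffDelta_eisensteinSeriesDelta_carrier_eq L e dV hdV dW hdW hdV0 hdW0 hχ hs hf hfc νN νN' hβ hβ' hβtop S h,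
    smul_whittakerDelta_carrier_eq L e dV hdV dW hdW νN νN' hβ hβ' S f h]

/-! ## §3 `hRK₁` OF THE TOP AT THE LETTERS OF RECORD, from the pinning at ONE carrier -/

/-- `n∕2 < re s` with `0 < n` forces `s ≠ ½`. [folklore] -/
theorem sub_half_ne_zero_of_lt_re (hn : 0 < n) {s : ℂ} (hs : (n : ℝ) / 2 < s.re) : s - 1 / 2 ≠ 0 := by
  intro h0
  have hs' : s = 1 / 2 := sub_eq_zero.1 h0
  have hre : s.re = 1 / 2 := by
    rw [hs']
    norm_num
  have hn1 : (1 : ℝ) ≤ n := by exact_mod_cast hn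
  rw [hre] at hs
  linarith

/-- **THE RANK-ONE COEFFICIENT AT THE LETTERS OF RECORD, EVERY CARRIER.**  `χ` unitary, `f_s ∈ I(s, χ)` a family of continuous Siegel sections, `(νN₀, β₀ ≤ 𝟙_{K₀})` ONE compactly
supported carrier of finite mass; `Ebc, Eac : Skew → ℂ → H(𝔸) → ℂ` pinned there on `{n∕2 < re s}` for rank-one indices (`S ≠ 0`, `det S = 0`):
`Ebc S s h = (∫β₀)⁻¹ • MID_S(νN₀, β₀, f_s, h)` and `Eac S s h = (s − ½)·((∫β₀)⁻¹ • W_S(νN₀)(f_s)(h))`.  THEN at EVERY Haar `νN` and EVERY covering weight `β`: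
`E_S(h; f_s) = Ebc S s h + (s − ½)⁻¹ · Eac S s h` on `{n∕2 < re s}` (★ p861869 §1 fed by §1–§2). [cite: KudlaRallis1994, §2] [cite: MoeglinWaldspurger1995, II.1.7] [cite: Tan1999, §3, §4 Prop. 4.8] -/
theorem fourierCoeffDelta_rankOne_eq_of_record (hdV0 : ∀ i, dV i ≠ 0) (hdW0 : ∀ i, dW i ≠ 0) (hn : 0 < n)
    [MeasurableSpace (unipDelta L e dV hdV dW hdW)] [BorelSpace (unipDelta L e dV hdV dW hdW)]
    (wq : unipDeltaRat L e dV hdV dW hdW → ratH L e dV hdV dW hdW)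
    (hwq : ∀ ν, ((wq ν : ratH L e dV hdV dW hdW) : HA L e dV hdV dW hdW) = weylDelta L e dV hdV dW hdW * ((ν : unipDelta L e dV hdV dW hdW) : HA L e dV hdV dW hdW))
    {χ : HeckeCharacter L} (hχ : χ.IsUnitary) (f : ℂ → HA L e dV hdV dW hdW → ℂ)
    (hf : ∀ s, IsSiegelDeltaSection L e dV hdV dW hdW χ s (f s)) (hfc : ∀ s, Continuous (f s))
    -- the reference carrier
    (νN₀ : Measure (unipDelta L e dV hdV dW hdW)) [νN₀.IsHaarMeasure] {β₀ : unipDelta L e dV hdV dW hdW → ℝ≥0∞}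
    (hβ₀ : IsCoveringWeight (unipDeltaRat L e dV hdV dW hdW) β₀) (hβ₀top : ∫⁻ u, β₀ u ∂νN₀ ≠ ∞)
    {K₀ : Set (unipDelta L e dV hdV dW hdW)} (hK₀ : IsCompact K₀) (hβ₀K : ∀ u, β₀ u ≤ K₀.indicator 1 u)
    -- the letters of record, pinned at the reference carrier on the half-plane of convergence
    (Ebc Eac : skewMatrices ((IsCMField.complexConj L : L ≃ₐ[Fp L] L) : L →+* L) ((gramR L e dV hdV dW hdW).map (algebraMap (Fp L) L)) → ℂ → HA L e dV hdV dW hdW → ℂ)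
    (hEbc : ∀ S : skewMatrices ((IsCMField.complexConj L : L ≃ₐ[Fp L] L) : L →+* L) ((gramR L e dV hdV dW hdW).map (algebraMap (Fp L) L)),
      (S : Matrix (Fin n) (Fin n) L) ≠ 0 → (S : Matrix (Fin n) (Fin n) L).det = 0 → ∀ (s : ℂ) (h : HA L e dV hdV dW hdW), (n : ℝ) / 2 < s.re →
        ((∫⁻ u, β₀ u ∂νN₀).toReal⁻¹ : ℝ) •
          (∫ u, (β₀ u).toReal • (conj (unipDeltaChar L e dV hdV dW hdW (S : Matrix (Fin n) (Fin n) L) (u : HA L e dV hdV dW hdW) : ℂ) *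
            (∑' q : ↥(({Quotient.mk (MulAction.orbitRel (siegelDeltaRat L e dV hdV dW hdW) (ratH L e dV hdV dW hdW)) 1} ∪
              Set.range (fun ν : unipDeltaRat L e dV hdV dW hdW =>
                (Quotient.mk (MulAction.orbitRel (siegelDeltaRat L e dV hdV dW hdW) (ratH L e dV hdV dW hdW)) (wq ν) :
                  SiegelDeltaQuot L e dV hdV dW hdW)))ᶜ : Set (SiegelDeltaQuot L e dV hdV dW hdW)),
              f s ((((Quotient.out (q : SiegelDeltaQuot L e dV hdV dW hdW) : ratH L e dV hdV dW hdW) : HA L e dV hdV dW hdW)) *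
                ((u : HA L e dV hdV dW hdW) * h)))) ∂νN₀) = Ebc S s h)
    (hEac : ∀ S : skewMatrices ((IsCMField.complexConj L : L ≃ₐ[Fp L] L) : L →+* L) ((gramR L e dV hdV dW hdW).map (algebraMap (Fp L) L)),
      (S : Matrix (Fin n) (Fin n) L) ≠ 0 → (S : Matrix (Fin n) (Fin n) L).det = 0 → ∀ (s : ℂ) (h : HA L e dV hdV dW hdW), (n : ℝ) / 2 < s.re →
        (s - 1 / 2) * (((∫⁻ u, β₀ u ∂νN₀).toReal⁻¹ : ℝ) • whittakerDelta L e dV hdV dW hdW νN₀ (S : Matrix (Fin n) (Fin n) L) (f s) h) = Eac S s h)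
    (S : skewMatrices ((IsCMField.complexConj L : L ≃ₐ[Fp L] L) : L →+* L) ((gramR L e dV hdV dW hdW).map (algebraMap (Fp L) L)))
    (hS0 : (S : Matrix (Fin n) (Fin n) L) ≠ 0) (hdet : (S : Matrix (Fin n) (Fin n) L).det = 0)
    (νN : Measure (unipDelta L e dV hdV dW hdW)) [νN.IsHaarMeasure] {β : unipDelta L e dV hdV dW hdW → ℝ≥0∞}
    (hβ : IsCoveringWeight (unipDeltaRat L e dV hdV dW hdW) β) {s : ℂ} (hs : (n : ℝ) / 2 < s.re) (h : HA L e dV hdV dW hdW) :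
    fourierCoeffDelta L e dV hdV dW hdW νN β (S : Matrix (Fin n) (Fin n) L) (eisensteinFamilyDelta L e dV hdV dW hdW f s) h =
      Ebc S s h + (s - 1 / 2)⁻¹ * Eac S s h := by
  have hs12 : s - 1 / 2 ≠ 0 := sub_half_ne_zero_of_lt_re hn hs
  exact fourierCoeffDelta_rankOne_eq_of_cells L e dV hdV dW hdW hdV0 hdW0 hn wq hwq hχ hs (hf s) (hfc s) S.2 hS0 (Ebc S s) (Eac S s) ((s - 1 / 2)⁻¹)
    (fun μ _ γ hγ _ hγtop K hK hγK x => by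
      rw [smul_middle_carrier_eq L e dV hdV dW hdW hdV0 hdW0 hn wq hwq hχ hs (hf s) (hfc s) S.2 hS0 μ νN₀ hγ hβ₀ hγtop hβ₀top hK hγK hK₀ hβ₀K x]
      exact hEbc S hS0 hdet s x hs)
    (fun μ _ γ hγ _ _ _ _ _ x => by
      rw [smul_whittakerDelta_carrier_eq L e dV hdV dW hdW μ νN₀ hγ hβ₀ (S : Matrix (Fin n) (Fin n) L) (f s) x, ← hEac S hS0 hdet s x hs, ← mul_assoc,
        inv_mul_cancel₀ hs12, one_mul])
    νN hβ h

/-- **`hRK₁` OF THE TOP AT THE LETTERS OF RECORD (the bytes of ★ ed. 9∕14∕15 and of ★ EdTwo p862260's `hRK₁` hole, at `ι := fun _ => Unit`, `a := 1`, `ρb := 1`,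
`ρa S s := (s − ½)⁻¹`, `Eb S _ := Ebc S`, `Ea S _ := Eac S`)**: from the pinning of `Ebc, Eac` at ONE compactly supported carrier (as in `fourierCoeffDelta_rankOne_eq_of_record`),
for every rank-one `S`, every Haar `νN`, every covering weight `β` (the mass conditions are carried as binders, unused), every `s` with `n∕2 < re s` and every `h`:
`E_S(h; f_s) = ∑ j : Unit, 1 * (1 * Ebc S s h + (s − ½)⁻¹ * Eac S s h)`. [cite: KudlaRallis1994, §2] [cite: MoeglinWaldspurger1995, II.1.7] [cite: Tan1999, §4 Prop. 4.8] -/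
theorem fourierCoeffDelta_rankOne_eq_of_record_sum (hdV0 : ∀ i, dV i ≠ 0) (hdW0 : ∀ i, dW i ≠ 0) (hn : 0 < n)
    [MeasurableSpace (unipDelta L e dV hdV dW hdW)] [BorelSpace (unipDelta L e dV hdV dW hdW)]
    (wq : unipDeltaRat L e dV hdV dW hdW → ratH L e dV hdV dW hdW)
    (hwq : ∀ ν, ((wq ν : ratH L e dV hdV dW hdW) : HA L e dV hdV dW hdW) = weylDelta L e dV hdV dW hdW * ((ν : unipDelta L e dV hdV dW hdW) : HA L e dV hdV dW hdW))
    {χ : HeckeCharacter L} (hχ : χ.IsUnitary) (f : ℂ → HA L e dV hdV dW hdW → ℂ)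
    (hf : ∀ s, IsSiegelDeltaSection L e dV hdV dW hdW χ s (f s)) (hfc : ∀ s, Continuous (f s))
    (νN₀ : Measure (unipDelta L e dV hdV dW hdW)) [νN₀.IsHaarMeasure] {β₀ : unipDelta L e dV hdV dW hdW → ℝ≥0∞}
    (hβ₀ : IsCoveringWeight (unipDeltaRat L e dV hdV dW hdW) β₀) (hβ₀top : ∫⁻ u, β₀ u ∂νN₀ ≠ ∞)
    {K₀ : Set (unipDelta L e dV hdV dW hdW)} (hK₀ : IsCompact K₀) (hβ₀K : ∀ u, β₀ u ≤ K₀.indicator 1 u)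
    (Ebc Eac : skewMatrices ((IsCMField.complexConj L : L ≃ₐ[Fp L] L) : L →+* L) ((gramR L e dV hdV dW hdW).map (algebraMap (Fp L) L)) → ℂ → HA L e dV hdV dW hdW → ℂ)
    (hEbc : ∀ S : skewMatrices ((IsCMField.complexConj L : L ≃ₐ[Fp L] L) : L →+* L) ((gramR L e dV hdV dW hdW).map (algebraMap (Fp L) L)),
      (S : Matrix (Fin n) (Fin n) L) ≠ 0 → (S : Matrix (Fin n) (Fin n) L).det = 0 → ∀ (s : ℂ) (h : HA L e dV hdV dW hdW), (n : ℝ) / 2 < s.re →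
        ((∫⁻ u, β₀ u ∂νN₀).toReal⁻¹ : ℝ) •
          (∫ u, (β₀ u).toReal • (conj (unipDeltaChar L e dV hdV dW hdW (S : Matrix (Fin n) (Fin n) L) (u : HA L e dV hdV dW hdW) : ℂ) *
            (∑' q : ↥(({Quotient.mk (MulAction.orbitRel (siegelDeltaRat L e dV hdV dW hdW) (ratH L e dV hdV dW hdW)) 1} ∪
              Set.range (fun ν : unipDeltaRat L e dV hdV dW hdW =>
                (Quotient.mk (MulAction.orbitRel (siegelDeltaRat L e dV hdV dW hdW) (ratH L e dV hdV dW hdW)) (wq ν) :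
                  SiegelDeltaQuot L e dV hdV dW hdW)))ᶜ : Set (SiegelDeltaQuot L e dV hdV dW hdW)),
              f s ((((Quotient.out (q : SiegelDeltaQuot L e dV hdV dW hdW) : ratH L e dV hdV dW hdW) : HA L e dV hdV dW hdW)) *
                ((u : HA L e dV hdV dW hdW) * h)))) ∂νN₀) = Ebc S s h)
    (hEac : ∀ S : skewMatrices ((IsCMField.complexConj L : L ≃ₐ[Fp L] L) : L →+* L) ((gramR L e dV hdV dW hdW).map (algebraMap (Fp L) L)),
      (S : Matrix (Fin n) (Fin n) L) ≠ 0 → (S : Matrix (Fin n) (Fin n) L).det = 0 → ∀ (s : ℂ) (h : HA L e dV hdV dW hdW), (n : ℝ) / 2 < s.re →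
        (s - 1 / 2) * (((∫⁻ u, β₀ u ∂νN₀).toReal⁻¹ : ℝ) • whittakerDelta L e dV hdV dW hdW νN₀ (S : Matrix (Fin n) (Fin n) L) (f s) h) = Eac S s h) :
    ∀ S : skewMatrices ((IsCMField.complexConj L : L ≃ₐ[Fp L] L) : L →+* L) ((gramR L e dV hdV dW hdW).map (algebraMap (Fp L) L)),
      (S : Matrix (Fin n) (Fin n) L) ≠ 0 → (S : Matrix (Fin n) (Fin n) L).det = 0 →
      ∀ (νN : Measure (unipDelta L e dV hdV dW hdW)) [νN.IsHaarMeasure] (β : unipDelta L e dV hdV dW hdW → ℝ≥0∞),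
      IsCoveringWeight (unipDeltaRat L e dV hdV dW hdW) β → ∫⁻ u, β u ∂νN ≠ 0 → ∫⁻ u, β u ∂νN ≠ ∞ →
      ∀ (s : ℂ) (h : HA L e dV hdV dW hdW), (n : ℝ) / 2 < s.re →
        fourierCoeffDelta L e dV hdV dW hdW νN β (S : Matrix (Fin n) (Fin n) L) (eisensteinFamilyDelta L e dV hdV dW hdW f s) h =
          ∑ _j : Unit, (1 : ℂ) * ((1 : ℂ) * Ebc S s h + (s - 1 / 2)⁻¹ * Eac S s h) := by
  intro S hS0 hdet νN _ β hβ _ _ s h hs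
  rw [Fintype.sum_unique, one_mul, one_mul]
  exact fourierCoeffDelta_rankOne_eq_of_record L e dV hdV dW hdW hdV0 hdW0 hn wq hwq hχ f hf hfc νN₀ hβ₀ hβ₀top hK₀ hβ₀K Ebc Eac hEbc hEac S hS0 hdet νN hβ hs h

/-! ## §4 The six kind-1 letters of ★ ed. 3b from the two ONE-CARRIER packages K1-b♮, K1-a♮ -/

/-- **THE SIX KIND-1 LETTERS OF THE TOP FROM THE LETTERS OF RECORD (one-carrier packages).**  Binders: the datum (`dV i, dW j ≠ 0`, `0 < n`), `χ` unitary, a family of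
continuous Siegel sections `f s ∈ I(s, χ)`, a pole set `P ∋ ½`, O41.4's rational Weyl presentation `(wq, hwq)`, ONE compactly supported carrier `(νN₀, β₀ ≤ 𝟙_{K₀})` of finite mass;
K1-b♮: `Ebc` holomorphic on `{0 < re}` with weighted growth `ub` and PINNED at `(νN₀, β₀)` to the normalised middle-cell term on `{n∕2 < re s}`; K1-a♮: `Eac` holomorphic on
`{0 < re}` with weighted growth `uG` and PINNED at `(νN₀, β₀)` to `(s − ½)·`(normalised Whittaker term); `Summable (ub + uG)`.  OUTPUT: ★ p861869 §2's conclusion verbatim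
(`∃ Ec₁` with `h1off`, `hd₁`, `hc₁`, `hcoef₁`, `hmaj₁`, `hgr₁`), via ★ p861869 §2 at `ρa S s := (s − ½)⁻¹`, `G := 1` and the carrier transport §1–§2.
[cite: Tan1999, §4 Prop. 4.8] [cite: MoeglinWaldspurger1995, IV.1.8–IV.1.11] [cite: KudlaRallis1994, §2] -/
theorem exists_kindOne_sixLetters_of_record (hdV0 : ∀ i, dV i ≠ 0) (hdW0 : ∀ i, dW i ≠ 0) (hn : 0 < n)
    [MeasurableSpace (unipDelta L e dV hdV dW hdW)] [BorelSpace (unipDelta L e dV hdV dW hdW)]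
    {χ : HeckeCharacter L} (hχ : χ.IsUnitary) (f : ℂ → HA L e dV hdV dW hdW → ℂ)
    (hf : ∀ s, IsSiegelDeltaSection L e dV hdV dW hdW χ s (f s)) (hfc : ∀ s, Continuous (f s)) (P : Finset ℂ) (hP : (1 / 2 : ℂ) ∈ P)
    (wq : unipDeltaRat L e dV hdV dW hdW → ratH L e dV hdV dW hdW)
    (hwq : ∀ ν, ((wq ν : ratH L e dV hdV dW hdW) : HA L e dV hdV dW hdW) = weylDelta L e dV hdV dW hdW * ((ν : unipDelta L e dV hdV dW hdW) : HA L e dV hdV dW hdW))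
    -- the reference carrier
    (νN₀ : Measure (unipDelta L e dV hdV dW hdW)) [νN₀.IsHaarMeasure] {β₀ : unipDelta L e dV hdV dW hdW → ℝ≥0∞}
    (hβ₀ : IsCoveringWeight (unipDeltaRat L e dV hdV dW hdW) β₀) (hβ₀top : ∫⁻ u, β₀ u ∂νN₀ ≠ ∞)
    {K₀ : Set (unipDelta L e dV hdV dW hdW)} (hK₀ : IsCompact K₀) (hβ₀K : ∀ u, β₀ u ≤ K₀.indicator 1 u)
    -- K1-b♮: the continued normalised middle-cell term
    (Ebc : skewMatrices ((IsCMField.complexConj L : L ≃ₐ[Fp L] L) : L →+* L) ((gramR L e dV hdV dW hdW).map (algebraMap (Fp L) L)) → ℂ → HA L e dV hdV dW hdW → ℂ)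
    (hEbd : ∀ S x, DifferentiableOn ℂ (fun s => Ebc S s x) {s : ℂ | 0 < s.re})
    -- K1-a♮: the continued `(s − ½)·`normalised Whittaker term
    (Eac : skewMatrices ((IsCMField.complexConj L : L ≃ₐ[Fp L] L) : L →+* L) ((gramR L e dV hdV dW hdW).map (algebraMap (Fp L) L)) → ℂ → HA L e dV hdV dW hdW → ℂ)
    (hEad : ∀ S x, DifferentiableOn ℂ (fun s => Eac S s x) {s : ℂ | 0 < s.re})
    -- the weights and the weighted growths
    (ub uG : skewMatrices ((IsCMField.complexConj L : L ≃ₐ[Fp L] L) : L →+* L) ((gramR L e dV hdV dW hdW).map (algebraMap (Fp L) L)) → ℝ)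
    (hub : ∀ S, 0 ≤ ub S) (huG : ∀ S, 0 ≤ uG S)
    (hbg : ∀ z : ℂ, 0 < z.re → ∃ C A r : ℝ, 0 ≤ C ∧ 0 ≤ A ∧ 0 < r ∧ ∀ S (s : ℂ), dist s z < r → ∀ x : HA L e dV hdV dW hdW,
      ‖Ebc S s x‖ ≤ C * ub S * adelicHeightGL (n + n) L (x : GL (Fin (n + n)) (AdeleRing (𝓞 L) L)) ^ A)
    (haG : ∀ z : ℂ, 0 < z.re → ∃ C A r : ℝ, 0 ≤ C ∧ 0 ≤ A ∧ 0 < r ∧ ∀ S (s : ℂ), dist s z < r → ∀ x : HA L e dV hdV dW hdW,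
      ‖Eac S s x‖ ≤ C * uG S * adelicHeightGL (n + n) L (x : GL (Fin (n + n)) (AdeleRing (𝓞 L) L)) ^ A)
    (hws : Summable fun S => ub S + uG S)
    -- the pinning at the reference carrier on the half-plane of convergence
    (hEbc : ∀ S : skewMatrices ((IsCMField.complexConj L : L ≃ₐ[Fp L] L) : L →+* L) ((gramR L e dV hdV dW hdW).map (algebraMap (Fp L) L)),
      (S : Matrix (Fin n) (Fin n) L) ≠ 0 → (S : Matrix (Fin n) (Fin n) L).det = 0 → ∀ (s : ℂ) (h : HA L e dV hdV dW hdW), (n : ℝ) / 2 < s.re →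
        ((∫⁻ u, β₀ u ∂νN₀).toReal⁻¹ : ℝ) •
          (∫ u, (β₀ u).toReal • (conj (unipDeltaChar L e dV hdV dW hdW (S : Matrix (Fin n) (Fin n) L) (u : HA L e dV hdV dW hdW) : ℂ) *
            (∑' q : ↥(({Quotient.mk (MulAction.orbitRel (siegelDeltaRat L e dV hdV dW hdW) (ratH L e dV hdV dW hdW)) 1} ∪
              Set.range (fun ν : unipDeltaRat L e dV hdV dW hdW =>
                (Quotient.mk (MulAction.orbitRel (siegelDeltaRat L e dV hdV dW hdW) (ratH L e dV hdV dW hdW)) (wq ν) :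
                  SiegelDeltaQuot L e dV hdV dW hdW)))ᶜ : Set (SiegelDeltaQuot L e dV hdV dW hdW)),
              f s ((((Quotient.out (q : SiegelDeltaQuot L e dV hdV dW hdW) : ratH L e dV hdV dW hdW) : HA L e dV hdV dW hdW)) *
                ((u : HA L e dV hdV dW hdW) * h)))) ∂νN₀) = Ebc S s h)
    (hEac : ∀ S : skewMatrices ((IsCMField.complexConj L : L ≃ₐ[Fp L] L) : L →+* L) ((gramR L e dV hdV dW hdW).map (algebraMap (Fp L) L)),
      (S : Matrix (Fin n) (Fin n) L) ≠ 0 → (S : Matrix (Fin n) (Fin n) L).det = 0 → ∀ (s : ℂ) (h : HA L e dV hdV dW hdW), (n : ℝ) / 2 < s.re →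
        (s - 1 / 2) * (((∫⁻ u, β₀ u ∂νN₀).toReal⁻¹ : ℝ) • whittakerDelta L e dV hdV dW hdW νN₀ (S : Matrix (Fin n) (Fin n) L) (f s) h) = Eac S s h) :
    ∃ Ec₁ : skewMatrices ((IsCMField.complexConj L : L ≃ₐ[Fp L] L) : L →+* L) ((gramR L e dV hdV dW hdW).map (algebraMap (Fp L) L)) → ℂ → HA L e dV hdV dW hdW → ℂ,
      (∀ S : skewMatrices ((IsCMField.complexConj L : L ≃ₐ[Fp L] L) : L →+* L) ((gramR L e dV hdV dW hdW).map (algebraMap (Fp L) L)),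
        ¬ ((S : Matrix (Fin n) (Fin n) L) ≠ 0 ∧ (S : Matrix (Fin n) (Fin n) L).det = 0) → ∀ s h, Ec₁ S s h = 0) ∧
      (∀ (S : skewMatrices ((IsCMField.complexConj L : L ≃ₐ[Fp L] L) : L →+* L) ((gramR L e dV hdV dW hdW).map (algebraMap (Fp L) L))) (h : HA L e dV hdV dW hdW),
        DifferentiableOn ℂ (fun s => Ec₁ S s h) {s : ℂ | 0 < s.re}) ∧
      (∀ (S : skewMatrices ((IsCMField.complexConj L : L ≃ₐ[Fp L] L) : L →+* L) ((gramR L e dV hdV dW hdW).map (algebraMap (Fp L) L))) (s : ℂ),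
        0 < s.re → Continuous (Ec₁ S s)) ∧
      (∀ (νN : Measure (unipDelta L e dV hdV dW hdW)) [νN.IsHaarMeasure] (β : unipDelta L e dV hdV dW hdW → ℝ≥0∞),
        IsCoveringWeight (unipDeltaRat L e dV hdV dW hdW) β → ∫⁻ u, β u ∂νN ≠ 0 → ∫⁻ u, β u ∂νN ≠ ∞ →
        ∀ S : skewMatrices ((IsCMField.complexConj L : L ≃ₐ[Fp L] L) : L →+* L) ((gramR L e dV hdV dW hdW).map (algebraMap (Fp L) L)),
        (S : Matrix (Fin n) (Fin n) L) ≠ 0 → (S : Matrix (Fin n) (Fin n) L).det = 0 →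
        ∀ (s : ℂ) (h : HA L e dV hdV dW hdW), (n : ℝ) / 2 < s.re →
          Ec₁ S s h = (∏ p ∈ P, (s - p)) * fourierCoeffDelta L e dV hdV dW hdW νN β (S : Matrix (Fin n) (Fin n) L) (eisensteinFamilyDelta L e dV hdV dW hdW f s) h) ∧
      (∀ z : ℂ, 0 < z.re → ∀ h₀ : HA L e dV hdV dW hdW, ∃ r > (0 : ℝ), ∃ V ∈ 𝓝 h₀,
        ∃ m : skewMatrices ((IsCMField.complexConj L : L ≃ₐ[Fp L] L) : L →+* L) ((gramR L e dV hdV dW hdW).map (algebraMap (Fp L) L)) → ℝ, Summable m ∧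
          ∀ s : ℂ, dist s z < r → ∀ h ∈ V, ∀ S, ‖Ec₁ S s h‖ ≤ m S) ∧
      (∀ z : ℂ, 0 < z.re → ∃ C A r : ℝ, 0 < r ∧ ∀ s : ℂ, dist s z < r → ∀ h : HA L e dV hdV dW hdW,
        (Summable fun S => ‖Ec₁ S s h‖) ∧ ∑' S, ‖Ec₁ S s h‖ ≤ C * adelicHeightGL (n + n) L (h : GL (Fin (n + n)) (AdeleRing (𝓞 L) L)) ^ A) := by
  refine exists_kindOne_sixLetters_of_cells L e dV hdV dW hdW hdV0 hdW0 hn hχ f hf hfc P hP wq hwq Ebc hEbd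
    (fun _ s => (s - 1 / 2)⁻¹) (fun _ _ => (1 : ℂ)) (fun _ => differentiableOn_const (1 : ℂ)) (fun _ s _ hs12 => ?_) Eac hEad ub uG hub huG hbg ?_ hws ?_ ?_
  · -- `hGρ` at `G := 1`, `ρa := (s − ½)⁻¹`
    exact (mul_inv_cancel₀ (sub_ne_zero.2 hs12)).symm
  · -- the growth of `G·Ea = 1·Eac`
    intro z hz
    obtain ⟨C, A, r, hC, hA, hr, hle⟩ := haG z hz
    exact ⟨C, A, r, hC, hA, hr, fun S s hsz x => by rw [one_mul]; exact hle S s hsz x⟩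
  · -- the middle-cell identity at EVERY compactly supported carrier (§2 transport to `(νN₀, β₀)` + pin)
    intro S hS0 hdet νN _ β hβ _ hβtop K hK hβK s h hs
    rw [smul_middle_carrier_eq L e dV hdV dW hdW hdV0 hdW0 hn wq hwq hχ hs (hf s) (hfc s) S.2 hS0 νN νN₀ hβ hβ₀ hβtop hβ₀top hK hβK hK₀ hβ₀K h]
    exact hEbc S hS0 hdet s h hs
  · -- the Whittaker identity at EVERY carrier (§1 transport + pin, `(s − ½)⁻¹·(s − ½) = 1`)
    intro S hS0 hdet νN _ β hβ _ _ _ _ _ s h hs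
    rw [smul_whittakerDelta_carrier_eq L e dV hdV dW hdW νN νN₀ hβ hβ₀ (S : Matrix (Fin n) (Fin n) L) (f s) h, ← hEac S hS0 hdet s h hs, ← mul_assoc,
      inv_mul_cancel₀ (sub_half_ne_zero_of_lt_re hn hs), one_mul]

end Summit.HodgeConjecture.HodgeConjecture.Cruxes.HLiu418.K2LiuKindOneLettersOfRecord

end
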